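import Summits.QuantumFields.GaugeBoot.Rows.KZL2rpD4CapBind
import Summits.QuantumFields.YangMills.Theorems.Instrument.BesselCapRows
import HarnessLib

/-!
# YM instrument cell — `SU(2)`, `D = 4`: the «| cap» BOXES `|y_v| ≤ ρ^{m(v)}` for all 10 878 kz-L2-rp-4D variables (A-plan-11)

Cell `ym-instrument` (HUMAN RULING D-0084 (2); director-ym R138; HOME `run/shared/lean/pub/ym-instrument/`), crew (a),
Lean typist seat `ym-instrument-boot-lean-1`. Question Q-A1, amendment A-plan-11 «BESSEL CAP»; ladder consequence: the «| cap» /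
«LIMIT | cap» rows of TABLE-A1 (IR `stmt-QuantumFields-19354`, THE NUMBER) built on the R0 kz-L2-rp-4D problem files
(`bounds.abs[v] = ρ^{m(v)}`) lose the named hypothesis `hBesselCap(ρ)` for their per-variable boxes.

HONEST FRAMING (page 1 of every file of this cell): WHAT IS CERTIFIED HERE, AT WHICH `(G, D, L, β)`: `G = SU(2)` (fundamental,
standard Wilson action), `D = 4`, EVERY periodic lattice `(ℤ/L)⁴` with `L ≥ 12` (even or odd), `β_std ∈ {9/5, 2, 11/5, 12/5}`: for every
variable `v` of the kz-L2-rp-4D label set, `|y β L v| = |⟨W_0(label v)⟩| ≤ ρ(β)^{m(v)}` with `m(v) = (KZL2rpD4.capWit v).length`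
(boot-plan's witness lists, exact maximum independent sets; histogram 0:42 1:40 2:819 3:675 4:9302) and the ρ of record
`2177/2500 · 2207/2500 · 558/625 · 9013/10000`. Source: `GaugeBoot.abs_wilsonExpectation_wordLoop_le_pow` through
`BesselCapRows.cap_b*_of_capCheck` and the kernel checks `KZL2rpD4.capCheck_label`. Fixed-coupling, `R`-independent perimeter-type
bounds; NOT an area law, NOT a mass gap; nothing summit-bearing; no hypothesis left to the reader.
-/

noncomputable section

namespace Summit.QuantumFields.YangMills.Theorems.Instrument

open Summit.QuantumFields.GaugeBoot
open Literature.MathematicalPhysics.QuantumFieldTheory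
open Literature.Analysis.FunctionSpaces (besselI)

/-- **BOXES, general `β`**: `|y β L v| ≤ ρ^{m(v)}` for all `v`, all tori `L ≥ 12`, whenever `0 < β`, `0 ≤ ρ`, `I₂(6β)/I₁(6β) ≤ ρ`. [folklore] -/
theorem abs_y_le_pow_capWit {β ρ : ℝ} (hβ : 0 < β) (hρ0 : 0 ≤ ρ) (hρ : besselI 2 (6 * β) / besselI 1 (6 * β) ≤ ρ)
    (L : ℕ) [NeZero L] (hL : 12 ≤ L) (v : Fin 10878) : |KZL2rpD4.y β L v| ≤ ρ ^ (KZL2rpD4.capWit v).length :=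
  abs_W_le_pow_of_capCheck hβ hρ0 hρ (KZL2rpD4.capCheck_label v) L hL

/-- **BOXES at `β_std = 9/5`**: `|y (9/5) L v| ≤ (2177/2500)^{m(v)}` for every `v` and every torus `L ≥ 12`. [folklore] -/
theorem abs_y_le_pow_capWit_b9o5 (L : ℕ) [NeZero L] (hL : 12 ≤ L) (v : Fin 10878) :
    |KZL2rpD4.y (9 / 5) L v| ≤ (2177 / 2500 : ℝ) ^ (KZL2rpD4.capWit v).length :=
  cap_b9o5_of_capCheck (KZL2rpD4.capCheck_label v) L hL

/-- **BOXES at `β_std = 2`**: `|y 2 L v| ≤ (2207/2500)^{m(v)}`. [folklore] -/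
theorem abs_y_le_pow_capWit_b2 (L : ℕ) [NeZero L] (hL : 12 ≤ L) (v : Fin 10878) :
    |KZL2rpD4.y 2 L v| ≤ (2207 / 2500 : ℝ) ^ (KZL2rpD4.capWit v).length :=
  cap_b2_of_capCheck (KZL2rpD4.capCheck_label v) L hL

/-- **BOXES at `β_std = 11/5`**: `|y (11/5) L v| ≤ (558/625)^{m(v)}`. [folklore] -/
theorem abs_y_le_pow_capWit_b11o5 (L : ℕ) [NeZero L] (hL : 12 ≤ L) (v : Fin 10878) :
    |KZL2rpD4.y (11 / 5) L v| ≤ (558 / 625 : ℝ) ^ (KZL2rpD4.capWit v).length :=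
  cap_b11o5_of_capCheck (KZL2rpD4.capCheck_label v) L hL

/-- **BOXES at `β_std = 12/5`**: `|y (12/5) L v| ≤ (9013/10000)^{m(v)}`. [folklore] -/
theorem abs_y_le_pow_capWit_b12o5 (L : ℕ) [NeZero L] (hL : 12 ≤ L) (v : Fin 10878) :
    |KZL2rpD4.y (12 / 5) L v| ≤ (9013 / 10000 : ℝ) ^ (KZL2rpD4.capWit v).length :=
  cap_b12o5_of_capCheck (KZL2rpD4.capCheck_label v) L hL

end Summit.QuantumFields.YangMills.Theorems.Instrument

end
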